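import Summits.NavierStokesRegularity.NavierStokesRegularity.Theorems.NoOverheating.Negative.ExtraFactorsTendingToOneExcluded
import HarnessLib

/-!
# KJ-63 — Window sequences that are ASYMPTOTICALLY self-similar at a fine scale ratio are
# excluded (route `AngularGalerkinLadder`, crux K2 `NoOverheating`; refuter lineage, Negative lane)

Stratum (S23), SEQUENCE-level, the scaling companion of (S18)–(S20) (symmetry DEFECTS tending to
zero) and the defect version of (S5)/(S22): if along an admissible window sequence the plain
self-similarity DEFECT at scales `lₙ → σ₀`, `1 < σ₀ < λ₁(C₀)` (Chae–Wolf's fine range), tends to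
zero pointwise on the past,
`lₙ uₙ(lₙ² t, lₙ x) − uₙ(t, x) → 0` (`t < 0`, `x ∈ ℝ³`),
then — by the JOINT space–time convergence of the ladder limit on compact cylinders
(`AngularGalerkinLadderLadderLimitJoint.exists_ladderLimit_joint`; the time argument `lₙ² t`
moves) — the cut-off limit is exactly `σ₀`-DSS, a classical Type-I (`C₀`) ancient solution for one
pressure on the whole past, and Chae–Wolf 2017 Thm. 1.3 (`chaeWolf2017_removing_dss_holds`, a
theorem of the tree) removes it, against non-triviality.  (S5) (`SelfSimilarWindowsExcluded`) and
the case `σ₀ > 1` of KJ-62b are the zero-defect cases.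

* `isDiscretelySelfSimilar_cutoff_of_defect_tendsto_zero` — the limit lemma (defect form);
* `no_windowSequence_asymptoticallySelfSimilar` — (S23) with convergent scales `lₙ → σ₀`;
* `no_windowSequence_asymptoticallySelfSimilar_const` — (S23) at one fixed scale `λ`.

READING FOR THE CIRCUIT: a K2 supply must keep its plain-DSS defect at every FINE scale ratio
`λ ∈ (1, λ₁(C₀))` bounded away from zero somewhere on the past, uniformly along the ladder; only
COARSE ratios (Chae–Wolf's `λ₁(C₀)` and beyond, the Pineau–Vicol middle band) escape.  No `kit`.
[cite: ChaeWolf2017RemovingDSS, Theorem 1.3 (arXiv:1610.09464 p. 3)]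
[cite: KochNadirashviliSereginSverak2009, Lemma 6.1 (limits of rescaled solutions)] -/

namespace Summit.NavierStokesRegularity.AngularGalerkinLadderAsymptoticSelfSimilarityExcluded

open Set Filter MeasureTheory Topology Function
open Literature.Analysis Literature.Analysis.FluidPDE
open Summit.NavierStokesRegularity.FluidComputer
open Summit.NavierStokesRegularity.FluidComputer.AngularLadder
open Summit.NavierStokesRegularity.AngularGalerkinLadderLadderLimitJoint
open Summit.NavierStokesRegularity.AngularGalerkinLadderFineRatioWindowsExcluded

/-! ## §1 A vanishing self-similarity defect passes to jointly-locally-uniform limits -/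

/-- **A vanishing plain-DSS defect at convergent scales makes the limit self-similar.**  If
`lₙ → λ > 0`, the defects `lₙ uₙ(lₙ² t, lₙ x) − uₙ(t, x)` tend to zero pointwise on `t < 0`,
`uₙ → v` pointwise on `t < 0` and uniformly on the compact cylinders
`[−(m+2), −1/(m+2)] × B̄(0, m+2)`, and `v` is jointly continuous on `(−∞, 0) × ℝ³`, then the
cut-off limit is `λ`-DSS. [cite: KochNadirashviliSereginSverak2009, Lemma 6.1 (limits of rescaled solutions)] -/
theorem isDiscretelySelfSimilar_cutoff_of_defect_tendsto_zero
    {u : ℕ → ℝ → EuclideanSpace ℝ (Fin 3) → EuclideanSpace ℝ (Fin 3)}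
    {v : ℝ → EuclideanSpace ℝ (Fin 3) → EuclideanSpace ℝ (Fin 3)} {l : ℕ → ℝ} {lam : ℝ}
    (hlt : Tendsto l atTop (𝓝 lam)) (hlam : 0 < lam)
    (hdef : ∀ t < 0, ∀ x,
      Tendsto (fun n => l n • u n ((l n) ^ 2 * t) (l n • x) - u n t x) atTop (𝓝 0))
    (hptw : ∀ t < 0, ∀ x, Tendsto (fun n => u n t x) atTop (𝓝 (v t x)))
    (hunif : ∀ m : ℕ, TendstoUniformlyOn (fun j => uncurry (u j)) (uncurry v) atTop
      (Icc (-((m : ℝ) + 2)) (-(1 / ((m : ℝ) + 2))) ×ˢ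
        Metric.closedBall (0 : EuclideanSpace ℝ (Fin 3)) ((m : ℝ) + 2)))
    (hvcont : ContinuousOn (uncurry v) (Iio 0 ×ˢ univ)) :
    IsDiscretelySelfSimilar lam (fun t x => if t < 0 then v t x else 0) := by
  unfold IsDiscretelySelfSimilar
  funext t x
  rw [nsRescale_apply]
  by_cases ht : t < 0
  · have hl2t : lam ^ 2 * t < 0 := mul_neg_of_pos_of_neg (by positivity) ht
    simp only [if_pos ht, if_pos hl2t]
    -- a compact cylinder around the limit point `z = (λ² t, λ x)`
    set a : ℝ := -(lam ^ 2 * t) with ha_def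
    have ha : 0 < a := by rw [ha_def]; linarith
    obtain ⟨m, hm⟩ := exists_nat_gt (a + a⁻¹ + ‖lam • x‖)
    have hainv : 0 < a⁻¹ := inv_pos.2 ha
    set S : Set (ℝ × EuclideanSpace ℝ (Fin 3)) :=
      Icc (-((m : ℝ) + 2)) (-(1 / ((m : ℝ) + 2))) ×ˢ
        Metric.closedBall (0 : EuclideanSpace ℝ (Fin 3)) ((m : ℝ) + 2) with hS
    have h_lo : -((m : ℝ) + 2) < lam ^ 2 * t := by
      have : a < (m : ℝ) + 2 := by linarith [norm_nonneg (lam • x)]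
      rw [ha_def] at this; linarith
    have h_hi : lam ^ 2 * t < -(1 / ((m : ℝ) + 2)) := by
      have h1 : a⁻¹ < (m : ℝ) + 2 := by linarith [norm_nonneg (lam • x)]
      have h2 : 1 / ((m : ℝ) + 2) < a := by
        rw [one_div]
        calc ((m : ℝ) + 2)⁻¹ < a⁻¹⁻¹ := inv_strictAnti₀ hainv h1
          _ = a := inv_inv a
      rw [ha_def] at h2; linarith
    have h_ball : lam • x ∈ Metric.ball (0 : EuclideanSpace ℝ (Fin 3)) ((m : ℝ) + 2) := by
      rw [Metric.mem_ball, dist_zero_right]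
      linarith [ha.le, hainv.le]
    have hSz : S ∈ 𝓝 ((lam ^ 2 * t, lam • x) : ℝ × EuclideanSpace ℝ (Fin 3)) := by
      refine mem_of_superset (prod_mem_nhds (isOpen_Ioo.mem_nhds ⟨h_lo, h_hi⟩)
        (Metric.isOpen_ball.mem_nhds h_ball)) ?_
      exact prod_mono Ioo_subset_Icc_self Metric.ball_subset_closedBall
    have hSsub : S ⊆ Iio 0 ×ˢ univ := by
      refine prod_mono (fun s hs => ?_) (subset_univ _)
      have hm0 : (0 : ℝ) < 1 / ((m : ℝ) + 2) := by positivity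
      exact lt_of_le_of_lt hs.2 (by linarith)
    -- the moving space–time points `zₙ = (lₙ² t, lₙ x) → z`, within `S`
    have hz : Tendsto (fun n => ((l n) ^ 2 * t, l n • x)) atTop
        (𝓝 ((lam ^ 2 * t, lam • x) : ℝ × EuclideanSpace ℝ (Fin 3))) :=
      ((hlt.pow 2).mul_const t).prodMk_nhds (hlt.smul tendsto_const_nhds)
    have hzS : Tendsto (fun n => ((l n) ^ 2 * t, l n • x)) atTop
        (𝓝[S] ((lam ^ 2 * t, lam • x) : ℝ × EuclideanSpace ℝ (Fin 3))) :=
      tendsto_nhdsWithin_iff.2 ⟨hz, hz.eventually_mem hSz⟩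
    have hcont : ContinuousWithinAt (uncurry v) S (lam ^ 2 * t, lam • x) :=
      (hvcont (lam ^ 2 * t, lam • x) (mk_mem_prod (mem_Iio.2 hl2t) (mem_univ _))).mono hSsub
    -- `lₙ uₙ(lₙ² t, lₙ x) → λ v(λ² t, λ x)` and `uₙ(t, x) → v(t, x)`; the defect tends to zero
    have hL : Tendsto (fun n => l n • u n ((l n) ^ 2 * t) (l n • x)) atTop
        (𝓝 (lam • v (lam ^ 2 * t) (lam • x))) :=
      hlt.smul ((hunif m).tendsto_comp hcont hzS)
    have h0 : lam • v (lam ^ 2 * t) (lam • x) - v t x = 0 :=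
      tendsto_nhds_unique (hL.sub (hptw t ht x)) (hdef t ht x)
    exact sub_eq_zero.1 h0
  · have hl2t : ¬ lam ^ 2 * t < 0 := fun h =>
      ht (by nlinarith [sq_nonneg lam, pow_pos hlam 2])
    simp only [if_neg ht, if_neg hl2t, smul_zero]

/-! ## §2 (S23): no admissible window sequence is asymptotically self-similar at a fine scale -/

/-- **(S23) No admissible window sequence has a vanishing plain-DSS defect at scales tending to a
fine ratio.**  For every `C₀` there is `c₁ = λ₁(C₀) > 1` such that constants `1 < cmin`, `0 < δ`,
`εₙ → 0`, window rung profiles with constant `C₀` at every index — ANY rotations, ANY window —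
and scales `lₙ → σ₀ ∈ (1, c₁)` with `lₙ uₙ(lₙ² t, lₙ x) − uₙ(t, x) → 0` pointwise on the past are
contradictory: the cut-off ladder limit (`exists_ladderLimit_joint`) is `σ₀`-DSS
(`isDiscretelySelfSimilar_cutoff_of_defect_tendsto_zero`), classical with one pressure on the
whole past (`exists_classical_Iio`), Type-I (`C₀`), hence zero by Chae–Wolf 2017 Thm. 1.3 — against
non-triviality.  (`C₀ ≤ 0` is vacuous by the amplitude floor.)
[cite: ChaeWolf2017RemovingDSS, Theorem 1.3 (arXiv:1610.09464 p. 3)] -/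
theorem no_windowSequence_asymptoticallySelfSimilar (C₀ : ℝ) :
    ∃ c₁ : ℝ, 1 < c₁ ∧ ∀ {cmin cmax δ σ₀ : ℝ} {L : ℕ → ℕ} {ε c l : ℕ → ℝ}
      {R : ℕ → (EuclideanSpace ℝ (Fin 3) ≃ₗᵢ[ℝ] EuclideanSpace ℝ (Fin 3))}
      {u : ℕ → ℝ → EuclideanSpace ℝ (Fin 3) → EuclideanSpace ℝ (Fin 3)}
      {p : ℕ → ℝ → EuclideanSpace ℝ (Fin 3) → ℝ}
      {d : ℕ → ℝ → EuclideanSpace ℝ (Fin 3) → EuclideanSpace ℝ (Fin 3)},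
      1 < σ₀ → σ₀ < c₁ → 1 < cmin → 0 < δ → Tendsto ε atTop (𝓝 0) →
      (∀ n, IsWindowProfile (L n) C₀ cmin cmax δ (ε n) (c n) (R n) (u n) (p n) (d n)) →
      Tendsto l atTop (𝓝 σ₀) →
      (∀ t < 0, ∀ x,
        Tendsto (fun n => l n • u n ((l n) ^ 2 * t) (l n • x) - u n t x) atTop (𝓝 0)) →
      False := by
  by_cases hC₀ : 0 < C₀
  swap
  · exact ⟨2, one_lt_two, fun _ _ _ hδ _ hW _ _ => hC₀ (typeI_const_pos_of_window hδ (hW 0))⟩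
  obtain ⟨c₁, hc₁, H⟩ := chaeWolf2017_removing_dss_holds C₀ hC₀
  refine ⟨c₁, hc₁,
    fun {cmin cmax δ σ₀ L ε c l R u p d} hσ₀ hσ₀c hcmin hδ hε hW hl hdef => ?_⟩
  obtain ⟨φ, c', R', v, hφ, -, -, -, hptw, -, hvcont, -, hTAM, -, -, hTI, -, hnz, hunif⟩ :=
    exists_ladderLimit_joint hcmin hδ hε hW
  set w : ℝ → EuclideanSpace ℝ (Fin 3) → EuclideanSpace ℝ (Fin 3) :=
    fun t x => if t < 0 then v t x else 0 with hwdef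
  have hw : IsDiscretelySelfSimilar σ₀ w :=
    isDiscretelySelfSimilar_cutoff_of_defect_tendsto_zero (u := fun n => u (φ n))
      (l := fun n => l (φ n)) (hl.comp hφ.tendsto_atTop) (by linarith)
      (fun t ht x => (hdef t ht x).comp hφ.tendsto_atTop) hptw hunif hvcont
  obtain ⟨P, hP⟩ := exists_classical_Iio hTAM
  have hwv : ∀ t ∈ Iio (0 : ℝ), w t = v t := fun t ht => by
    funext x
    simp only [hwdef, if_pos (mem_Iio.1 ht)]
  have hPw : IsClassicalNSSolutionOn (Iio 0) 1 0 w P := hP.congr_velocity hwv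
  have hTIw : HasTypeIDecay C₀ w := fun t ht x => by
    simp only [hwdef, if_pos ht]
    exact hTI t ht x
  have hz : ∀ t < 0, ∀ x, w t x = 0 := H σ₀ hσ₀ hσ₀c w P hPw hw hTIw
  refine hnz fun t ht => Eventually.of_forall fun x => ?_
  have h3 := hz t ht x
  simp only [hwdef, if_pos ht] at h3
  simpa using h3

/-- **(S23) at one fixed fine scale `λ`.**  For every `C₀` there is `c₁ > 1` such that no
admissible window sequence has `λ uₙ(λ² t, λ x) − uₙ(t, x) → 0` pointwise on the past for a
`λ ∈ (1, c₁)`; (S5) (`SelfSimilarWindowsExcluded.no_windowSequence_extraFineFactor`) is the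
zero-defect case. [cite: ChaeWolf2017RemovingDSS, Theorem 1.3 (arXiv:1610.09464 p. 3)] -/
theorem no_windowSequence_asymptoticallySelfSimilar_const (C₀ : ℝ) :
    ∃ c₁ : ℝ, 1 < c₁ ∧ ∀ {cmin cmax δ lam : ℝ} {L : ℕ → ℕ} {ε c : ℕ → ℝ}
      {R : ℕ → (EuclideanSpace ℝ (Fin 3) ≃ₗᵢ[ℝ] EuclideanSpace ℝ (Fin 3))}
      {u : ℕ → ℝ → EuclideanSpace ℝ (Fin 3) → EuclideanSpace ℝ (Fin 3)}
      {p : ℕ → ℝ → EuclideanSpace ℝ (Fin 3) → ℝ}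
      {d : ℕ → ℝ → EuclideanSpace ℝ (Fin 3) → EuclideanSpace ℝ (Fin 3)},
      1 < lam → lam < c₁ → 1 < cmin → 0 < δ → Tendsto ε atTop (𝓝 0) →
      (∀ n, IsWindowProfile (L n) C₀ cmin cmax δ (ε n) (c n) (R n) (u n) (p n) (d n)) →
      (∀ t < 0, ∀ x,
        Tendsto (fun n => lam • u n (lam ^ 2 * t) (lam • x) - u n t x) atTop (𝓝 0)) →
      False := by
  obtain ⟨c₁, hc₁, H⟩ := no_windowSequence_asymptoticallySelfSimilar C₀
  exact ⟨c₁, hc₁, fun hlam1 hlamc hcmin hδ hε hW hdef =>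
    H hlam1 hlamc hcmin hδ hε hW (l := fun _ => _) tendsto_const_nhds hdef⟩

end Summit.NavierStokesRegularity.AngularGalerkinLadderAsymptoticSelfSimilarityExcluded
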